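import Summits.AtomisticToContinuum.Crystallization.Theorems.ChartedZeroExcessLayeredLatticeLiouvilleQ

/-!
# The discrete-rigidity PIECE of the registration line (26636; hand-1 g17, critic rows 635 (C) / 644 (D)(E))

ONE typed input shared by (A0♯⁺) `BondIsoLevelsP` (steps L2/L3 of hand-1's sizing memo) and — if lens-2 g38 confirms — (Υc)
`UntwistCollarP`: a DISCRETE GEOMETRIC-RIGIDITY estimate with a constant UNIFORM in the window radius (dilation invariance) on
door-set windows (`CleanWindowRigidityP`) and on windows of a perfect layered configuration (`LayeredWindowRigidityP`, the
perfect-to-perfect variant that (L2) consumes literally).  Statements only (`[piece]`), plus the one-line monotonicity seams.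
No Literature named fact is introduced (critic row 644 (D): FJM stays a citation until a literal continuum consumer exists).

Sources (prose citations, deliberately not gate tags): Friesecke–James–Müller, Comm. Pure Appl. Math. 55 (2002), Thm 3.1 (the
continuum rigidity estimate, constant invariant under dilations); Flatley–Theil, Arch. Ration. Mech. Anal. 2015 (arXiv 1407.0692),
Thm 4.1 (FJM with the invariance stated), Prop 4.2 and Lemma 4.3 (the DISCRETE 3-D `L²` estimate with a universal constant for FCC
reference configurations on scaled octahedra, via the tetra/octa cell lemma — the template of the intended proof); Kružík–Roubíček,
Mathematical Methods in Continuum Mechanics of Solids (2019), Thm 1.1.12.  Not verbatim in print for hcp / stacking-faulted layered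
references or ball windows (hand-1 NODE-MEMO-A0sharp-rigidity.md §3); hence a piece, to be PROVED from the cell lemma + FJM + (P).
-/

noncomputable section

open scoped BigOperators
open MeasureTheory Set Metric
open Summit.AtomisticToContinuum.Crystallization.Theorems.ChartedPlanarOrderRigidityDoor (E3 atomsIn)
open Summit.AtomisticToContinuum.Crystallization.Theorems.ChartedPlanarOrderDensityDichotomy (μS)
open Summit.AtomisticToContinuum.Crystallization.Theorems.ChartedPlanarOrderMesoCut (LayeredHom)
open Summit.AtomisticToContinuum.Crystallization.Theorems.ChartedPlanarOrderCleanScaleP (IsDoorSetP isDoorSetP_mono)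

namespace Summit.AtomisticToContinuum.Crystallization.Theorems.ChartedZeroExcessLayeredLatticeLiouville

/-- the squared `4`-bond GRADIENT defect of a map `Ψ` against a linear isometry `Q` on a window `W`:
`Σ_{x ∈ W} Σ_{p ∈ W, dist p x ≤ 4} ‖(Ψ p − Ψ x) − Q (p − x)‖²`. -/
def bondGradDefect (W : Set E3) (Ψ : E3 → E3) (Q : E3 ≃ₗᵢ[ℝ] E3) : ℝ :=
  ∑ᶠ x ∈ W, ∑ᶠ p ∈ W ∩ closedBall x 4, ‖(Ψ p - Ψ x) - Q (p - x)‖ ^ 2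

/-- the squared `4`-bond LENGTH distortion of a map `Ψ` on a window `W`: `Σ_{x ∈ W} Σ_{p ∈ W, dist p x ≤ 4} (dist (Ψ p) (Ψ x) − dist p x)²`
(the right-hand side of Flatley–Theil's Prop 4.2). -/
def bondLengthDefect (W : Set E3) (Ψ : E3 → E3) : ℝ :=
  ∑ᶠ x ∈ W, ∑ᶠ p ∈ W ∩ closedBall x 4, (dist (Ψ p) (Ψ x) - dist p x) ^ 2

/-- ★★ **(R1) «CleanWindowRigidityP aHi»** — DISCRETE GEOMETRIC RIGIDITY ON DOOR-SET WINDOWS: for every separation `δ` there are a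
constant `C_R ≥ 1` and a floor `R₁` such that for every `aHi`-door set `S` (rooted, `δ`-separated, clean, Nash, charted), every radius
`R ≥ R₁` and every map `Ψ` whose `4`-bond length distortions on the window `win R = atomsIn (μS S) 0 R` are at most `1/10` (the
«no folded unit» condition of the cell lemma — reflections of single tetrahedra have zero length distortion), there is ONE linear
isometry `Q` of `E3` with `bondGradDefect (win R) Ψ Q ≤ C_R · bondLengthDefect (win R) Ψ`.  `C_R` does not depend on `R` (dilation
invariance of the rigidity constant) nor on `S`.  With (P) `windowPoincareP_one` it yields the position form `Σ ‖Ψ x − (Q x + c)‖² ≤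
C_R·C_P·R²·bondLengthDefect`.  GENERIC DISCRETE ANALYSIS · TRUE-type · ATTACKABLE · M–L (cell lemma on the tetra/octa units of a clean
window + the continuum estimate on their union + read-back at the nodes). [piece] -/
def CleanWindowRigidityP (aHi : ℝ) : Prop :=
  ∀ δ : ℝ, 0 < δ → ∃ CR : ℝ, 1 ≤ CR ∧ ∃ R₁ : ℝ, 0 < R₁ ∧ ∀ S : Set E3, IsDoorSetP aHi δ S → ∀ R : ℝ, R₁ ≤ R →
    ∀ Ψ : E3 → E3,
      (∀ x ∈ atomsIn (μS S) 0 R, ∀ p ∈ atomsIn (μS S) 0 R, dist p x ≤ 4 → |dist (Ψ p) (Ψ x) - dist p x| ≤ 1 / 10) →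
        ∃ Q : E3 ≃ₗᵢ[ℝ] E3, bondGradDefect (atomsIn (μS S) 0 R) Ψ Q ≤ CR * bondLengthDefect (atomsIn (μS S) 0 R) Ψ

/-- ★★ **(R2) «LayeredWindowRigidityP a s Λ»** — THE PERFECT-TO-PERFECT VARIANT (the literal input of (A0♯⁺)'s dyadic chart comparison):
the same estimate on the windows `LayeredHom L w ∩ closedBall y R` of the model of any equilibrium chart `(L, w)` (`IsEquilChart a s Λ L w`),
centred at any model point `y`, with `C_R` uniform in `L, w, y, R`.  TRUE-type · ATTACKABLE · M (source configuration perfect). [piece] -/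
def LayeredWindowRigidityP (a s Λ : ℝ) : Prop :=
  ∃ CR : ℝ, 1 ≤ CR ∧ ∃ R₁ : ℝ, 0 < R₁ ∧ ∀ (L : E3 ≃L[ℝ] E3) (w : ℤ → E3), IsEquilChart a s Λ L w →
    ∀ y ∈ LayeredHom (L : E3 →L[ℝ] E3) w, ∀ R : ℝ, R₁ ≤ R → ∀ Ψ : E3 → E3,
      (∀ x ∈ LayeredHom (L : E3 →L[ℝ] E3) w ∩ closedBall y R, ∀ p ∈ LayeredHom (L : E3 →L[ℝ] E3) w ∩ closedBall y R,
          dist p x ≤ 4 → |dist (Ψ p) (Ψ x) - dist p x| ≤ 1 / 10) →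
        ∃ Q : E3 ≃ₗᵢ[ℝ] E3, bondGradDefect (LayeredHom (L : E3 →L[ℝ] E3) w ∩ closedBall y R) Ψ Q ≤
          CR * bondLengthDefect (LayeredHom (L : E3 →L[ℝ] E3) w ∩ closedBall y R) Ψ

/-! ## One-line seams -/

/-- (R1) is antitone in the scale ceiling: more door sets at a larger `aHi`. [this file] -/
theorem cleanWindowRigidityP_anti {aHi aHi' : ℝ} (hle : aHi ≤ aHi') (h : CleanWindowRigidityP aHi') :
    CleanWindowRigidityP aHi := by
  intro δ hδ
  obtain ⟨CR, hCR, R₁, hR₁, H⟩ := h δ hδ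
  exact ⟨CR, hCR, R₁, hR₁, fun S hS => H S (isDoorSetP_mono hle hS)⟩

/-- the gradient defect is nonnegative. [this file] -/
theorem bondGradDefect_nonneg (W : Set E3) (Ψ : E3 → E3) (Q : E3 ≃ₗᵢ[ℝ] E3) : 0 ≤ bondGradDefect W Ψ Q :=
  finsum_nonneg fun _ => finsum_nonneg fun _ => finsum_nonneg fun _ => finsum_nonneg fun _ => sq_nonneg _

/-- the length defect is nonnegative. [this file] -/
theorem bondLengthDefect_nonneg (W : Set E3) (Ψ : E3 → E3) : 0 ≤ bondLengthDefect W Ψ :=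
  finsum_nonneg fun _ => finsum_nonneg fun _ => finsum_nonneg fun _ => finsum_nonneg fun _ => sq_nonneg _

/-- an exact isometry has zero length defect, so (R1) forces its gradient defect against SOME linear isometry to vanish — the
non-vacuity direction of the piece (identity map: `Q := 1` works trivially; stated as the sanity consequence). [this file] -/
theorem bondLengthDefect_of_isometry (W : Set E3) (Q : E3 ≃ₗᵢ[ℝ] E3) (c : E3) :
    bondLengthDefect W (fun x => Q x + c) = 0 := by
  have h : ∀ x p : E3, (dist (Q p + c) (Q x + c) - dist p x) ^ 2 = 0 := by
    intro x p
    have : dist (Q p + c) (Q x + c) = dist p x := by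
      rw [dist_eq_norm, dist_eq_norm, add_sub_add_right_eq_sub, ← map_sub, LinearIsometryEquiv.norm_map]
    rw [this, sub_self, zero_pow two_ne_zero]
  simp only [bondLengthDefect, h, finsum_zero]

end Summit.AtomisticToContinuum.Crystallization.Theorems.ChartedZeroExcessLayeredLatticeLiouville

end
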